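import Literature.RingTheory.KTheory.MilnorKStar
import Mathlib.GroupTheory.FreeAbelianGroup
import Mathlib.GroupTheory.QuotientGroup.Defs
import HarnessLib

/-!
# The grading of `K_*R`: the canonical maps `K_nR → K_*R` are injective and `K_*R = ⊕ₙ K_nR`
# (Milnor, *Algebraic K-theory and quadratic forms*, Invent. Math. 9 (1970), §1, «In other words …»)

Family `hodge`, lane `lit-hodgefound` (foundations library; seat `lit-hodgefound-p27`, generation 40, row g40-#8);
topic `RingTheory/KTheory`.  Sequel of `MilnorKStar` (g40-#7: Milnor's ring `K_*R = MilnorKStar R`, the tensor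
algebra of `K₁R` over `ℤ` modulo the ideal generated by the `l(a) ⊗ l(1−a)`; the canonical maps
`ofDeg R n : K_nR →+ K_*R`, multiplicative (`ofDeg_mul`) and jointly generating (`iSup_range_ofDeg`)) and of
`MilnorKGroups` (g39-#12: the groups `K_nR = MilnorK R n`, i.e. the degree-wise quotients «of the n-fold tensor
product K₁F ⊗ ⋯ ⊗ K₁F by the subgroup generated by all l(a₁) ⊗ ⋯ ⊗ l(aₙ) such that aᵢ + aᵢ₊₁ = 1 for some i»,
with `symbol`, `hom_ext`, `symbol_update_mul`, `symbol_eq_zero_of_add_eq_one`, `castEquiv`).  This file proves the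
«In other words» of the source: the two descriptions agree, i.e. the `ofDeg R n` are injective and `K_*R` is the direct
sum of their images.  DEFINITIONS WITH BODIES (`GSym`, `modelRels`, `modelRelSubgroup`, the `abbrev GradedModel`,
`gsymbol`, `gradedModelLift`, `gact`, `gactEnd`, `gactHom`, `grho`, `gproj`, `gcomponent`, `gtotal`, `gradedEquiv`)
and PROVED THEOREMS; no named fact, no instance, no notation, 0 `sorry`, net debt 0 (D-0026).

## The source, verbatim

J. Milnor, *Algebraic K-theory and quadratic forms*, Invent. Math. 9 (1970) 318–344 (held `paper:doi-10-1007-bf01425486`;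
bib key `Milnor1970`), §1 (p0002 L5–L20): «Then K_*F is defined to be the quotient of the tensor algebra
(ℤ, K₁F, K₁F ⊗ K₁F, …) by the ideal generated by all l(a) ⊗ l(1−a) with a ≠ 0, 1. In other words each K_nF, n ≥ 2,
is the quotient of the n-fold tensor product K₁F ⊗ ⋯ ⊗ K₁F by the subgroup generated by all l(a₁) ⊗ ⋯ ⊗ l(aₙ)
such that aᵢ + aᵢ₊₁ = 1 for some i. In terms of generators and relations, K_*F can be described as the associative
ring with unit which is generated by symbols l(a), a ∈ F•, subject only to the defining relations l(ab) = l(a) + l(b)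
and l(a)l(1−a) = 0.»

## What is formalised

The model `⊕ₙ K_nR` is built WITHOUT a dependent direct sum (Lean's instance synthesis does not solve
`∀ n, AddCommGroup (MilnorK R n)` under the binder — the `PiTensorProduct` instance leaves a delayed unification
`CommGroup Rˣ ≟ CommGroup ?ˣ`; checked in a probe file, already for a constant family), as the presentation of all
degrees at once: **`GradedModel R := FreeAbelianGroup (Σ n, Fin n → Rˣ) ⧸ ⟨multilinearity in each slot, adjacent
Steinberg relations⟩`** — degree by degree this is the presentation of `K_nR` «by the subgroup generated by all
l(a₁) ⊗ ⋯ ⊗ l(aₙ) such that aᵢ + aᵢ₊₁ = 1», with the tensor product unfolded into multilinearity.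

* §1 `GradedModel`, the symbols `gsymbol R n c`, their relations (`gsymbol_update_mul`,
  `gsymbol_eq_zero_of_add_eq_one`), `gradedModel_hom_ext` and the universal property **`gradedModelLift`**.
* §2 **the action of `K_*R` on the model**: `gact a : {c} ↦ {a, c}` (well defined: `Fin.cons` carries relations to
  relations), `gact_mul : gact (ab) = gact a + gact b` (multilinearity in slot `0`), `gact_gact_eq_zero` (the Steinberg
  relation in slots `0, 1`), hence by the universal properties of the tensor algebra and of `RingQuot` the ring
  homomorphism **`grho : K_*R →ₐ[ℤ] AddMonoid.End (GradedModel R)`** with `grho (l a) = gact a`, and the projection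
  **`gproj : K_*R →+ GradedModel R`**, `x ↦ grho x {}`, with **`gproj_ofDeg_symbol : gproj (l(c₁)⋯l(cₙ)) = {c₁, …, cₙ}`**.
* §3 **the components** `gcomponent R n : GradedModel R →+ K_nR` (`{c} ↦ {c}` in degree `n`, `0` in the other
  degrees), **`gcomponent_gproj_ofDeg : gcomponent n (gproj (ofDeg n x)) = x`**, whence
  **`ofDeg_injective : Function.Injective (ofDeg R n)`** and **`iSupIndep_range_ofDeg`** (the images of the `K_nR`
  in `K_*R` are independent; with `iSup_range_ofDeg` of `MilnorKStar` they form an internal direct sum decomposition);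
  finally `gtotal : GradedModel R →+ K_*R` (`{c} ↦ l(c₁)⋯l(cₙ)`), `gproj_gtotal`, `gtotal_gproj` and the additive
  isomorphism **`gradedEquiv : K_*R ≃+ GradedModel R`** carrying `ofDeg n {c}` to the degree-`n` symbol `{c}`.

## References

* [Milnor1970] J. Milnor, *Algebraic K-theory and quadratic forms*, Invent. Math. 9 (1970) 318–344 — §1, the
  definition of `K_*F` and its degree-wise description (p0002 L5–L20).

Provenance: lane `lit-hodgefound`, seat `lit-hodgefound-p27` gen 40 (agent `literature-prover-lit-hodgefound-p27-g40-0`),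
row g40-#8.
-/

set_option autoImplicit false

noncomputable section

namespace Literature.RingTheory.KTheory

open Function

/-! ### the grading: «in other words», `K_*R = ⊕ₙ K_nR` -/

section Graded

variable (R : Type*) [CommRing R]

namespace MilnorKStar

/-- The generators of all degrees: pairs `(n, (c₁, …, cₙ))` of a degree and an `n`-tuple of units. [cite: Milnor1970, §1 «In other words …» (p0002 L15–L18)] -/
abbrev GSym : Type _ := Σ n : ℕ, (Fin n → Rˣ)

/-- The relations of all the groups `K_nR` at once, on the free abelian group on the generators of all degrees:
multilinearity `{…, xy, …} = {…, x, …} + {…, y, …}` in each slot (the tensor product) and the adjacent Steinberg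
relations `{…, cᵢ, cᵢ₊₁, …} = 0` for `cᵢ + cᵢ₊₁ = 1` («the subgroup generated by all l(a₁) ⊗ ⋯ ⊗ l(aₙ) such that
aᵢ + aᵢ₊₁ = 1 for some i»). [cite: Milnor1970, §1 «In other words each K_nF, n ≥ 2, is the quotient of the n-fold tensor product K₁F ⊗ ⋯ ⊗ K₁F by the subgroup generated by all l(a₁) ⊗ ⋯ ⊗ l(aₙ) such that aᵢ + aᵢ₊₁ = 1 for some i» (p0002 L15–L18)] -/
def modelRels : Set (FreeAbelianGroup (GSym R)) :=
  {z | (∃ (n : ℕ) (c : Fin n → Rˣ) (i : Fin n) (x y : Rˣ),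
      z = FreeAbelianGroup.of ⟨n, update c i (x * y)⟩ -
        (FreeAbelianGroup.of ⟨n, update c i x⟩ + FreeAbelianGroup.of ⟨n, update c i y⟩)) ∨
    (∃ (n : ℕ) (c : Fin n → Rˣ) (i : Fin n) (h : i.val + 1 < n), (c i : R) + c (finSucc i h) = 1 ∧
      z = FreeAbelianGroup.of ⟨n, c⟩)}

/-- The subgroup generated by the relations `modelRels`. [cite: Milnor1970, §1 «In other words …» (p0002 L15–L18)] -/
def modelRelSubgroup : AddSubgroup (FreeAbelianGroup (GSym R)) := AddSubgroup.closure (modelRels R)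

/-- **The graded model `⊕ₙ K_nR`**: the free abelian group on the symbols of all degrees modulo multilinearity and the
adjacent Steinberg relations — degree by degree the presentation of `K_nR` of the source.  (An `abbrev` of a
quotient group, so Mathlib's instances apply; no instance is declared.  A dependent direct sum `⨁ n, MilnorK R n` is
avoided because instance synthesis for that family fails under the binder.) [cite: Milnor1970, §1 «In other words each K_nF, n ≥ 2, is the quotient of the n-fold tensor product K₁F ⊗ ⋯ ⊗ K₁F by the subgroup generated by all l(a₁) ⊗ ⋯ ⊗ l(aₙ) such that aᵢ + aᵢ₊₁ = 1 for some i» (p0002 L15–L18)] -/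
abbrev GradedModel : Type _ := FreeAbelianGroup (GSym R) ⧸ modelRelSubgroup R

/-- The symbol `{c₁, …, cₙ}` of degree `n` in the graded model. [cite: Milnor1970, §1 «In other words …» (p0002 L15–L18)] -/
def gsymbol (n : ℕ) (c : Fin n → Rˣ) : GradedModel R := QuotientAddGroup.mk (FreeAbelianGroup.of ⟨n, c⟩)

/-- `gsymbol` unfolded. [cite: Milnor1970, §1 «In other words …» (p0002 L15–L18)] -/
theorem gsymbol_def (n : ℕ) (c : Fin n → Rˣ) :
    gsymbol R n c = QuotientAddGroup.mk (FreeAbelianGroup.of ⟨n, c⟩) := rfl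

/-- Multilinearity of the symbols of the graded model in each slot. [cite: Milnor1970, §1 «In other words …» (p0002 L15–L18)] -/
theorem gsymbol_update_mul (n : ℕ) (c : Fin n → Rˣ) (i : Fin n) (x y : Rˣ) :
    gsymbol R n (update c i (x * y)) = gsymbol R n (update c i x) + gsymbol R n (update c i y) := by
  rw [gsymbol, gsymbol, gsymbol, ← QuotientAddGroup.mk_add, QuotientAddGroup.eq_iff_sub_mem]
  exact AddSubgroup.subset_closure (Or.inl ⟨n, c, i, x, y, rfl⟩)

/-- The adjacent Steinberg relation in the graded model: `{…, cᵢ, cᵢ₊₁, …} = 0` if `cᵢ + cᵢ₊₁ = 1`. [cite: Milnor1970, §1 «In other words each K_nF, n ≥ 2, is the quotient of the n-fold tensor product K₁F ⊗ ⋯ ⊗ K₁F by the subgroup generated by all l(a₁) ⊗ ⋯ ⊗ l(aₙ) such that aᵢ + aᵢ₊₁ = 1 for some i» (p0002 L15–L18)] -/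
theorem gsymbol_eq_zero_of_add_eq_one (n : ℕ) (c : Fin n → Rˣ) (i : Fin n) (h : i.val + 1 < n)
    (hsum : (c i : R) + c (finSucc i h) = 1) : gsymbol R n c = 0 := by
  rw [gsymbol, QuotientAddGroup.eq_zero_iff]
  exact AddSubgroup.subset_closure (Or.inr ⟨n, c, i, h, hsum, rfl⟩)

/-- Additive maps out of the graded model agreeing on symbols agree. [cite: Milnor1970, §1 «In other words …» (p0002 L15–L18)] -/
theorem gradedModel_hom_ext {A : Type*} [AddCommGroup A] {f g : GradedModel R →+ A}
    (h : ∀ (n : ℕ) (c : Fin n → Rˣ), f (gsymbol R n c) = g (gsymbol R n c)) : f = g :=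
  QuotientAddGroup.addMonoidHom_ext _ (FreeAbelianGroup.lift_ext _ _ fun p => h p.1 p.2)

/-- **Universal property of the graded model**: a family of maps on tuples, multilinear in each slot and killed by the
adjacent Steinberg relations, extends to an additive map. [cite: Milnor1970, §1 «In other words …» (p0002 L15–L18)] -/
def gradedModelLift {A : Type*} [AddCommGroup A] (f : ∀ n : ℕ, (Fin n → Rˣ) → A)
    (hmul : ∀ (n : ℕ) (c : Fin n → Rˣ) (i : Fin n) (x y : Rˣ),
      f n (update c i (x * y)) = f n (update c i x) + f n (update c i y))
    (hst : ∀ (n : ℕ) (c : Fin n → Rˣ) (i : Fin n) (h : i.val + 1 < n), (c i : R) + c (finSucc i h) = 1 → f n c = 0) :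
    GradedModel R →+ A :=
  QuotientAddGroup.lift (modelRelSubgroup R) (FreeAbelianGroup.lift fun p : GSym R => f p.1 p.2) (by
    rw [modelRelSubgroup, AddSubgroup.closure_le]
    rintro z (⟨n, c, i, x, y, rfl⟩ | ⟨n, c, i, h, hsum, rfl⟩)
    · rw [SetLike.mem_coe, AddMonoidHom.mem_ker, map_sub, map_add, FreeAbelianGroup.lift_apply_of,
        FreeAbelianGroup.lift_apply_of, FreeAbelianGroup.lift_apply_of, hmul, sub_self]
    · rw [SetLike.mem_coe, AddMonoidHom.mem_ker, FreeAbelianGroup.lift_apply_of]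
      exact hst n c i h hsum)

/-- `gradedModelLift f` on symbols. [cite: Milnor1970, §1 «In other words …» (p0002 L15–L18)] -/
theorem gradedModelLift_gsymbol {A : Type*} [AddCommGroup A] (f : ∀ n : ℕ, (Fin n → Rˣ) → A) (hmul) (hst) (n : ℕ)
    (c : Fin n → Rˣ) : gradedModelLift R f hmul hst (gsymbol R n c) = f n c := by
  rw [gradedModelLift, gsymbol, QuotientAddGroup.lift_mk, FreeAbelianGroup.lift_apply_of]

/-- `finSucc` commutes with `Fin.succ`. [folklore] -/
private theorem finSucc_succ {n : ℕ} (i : Fin n) (h : i.val + 1 < n) (h' : (i.succ).val + 1 < n + 1) :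
    finSucc i.succ h' = (finSucc i h).succ := Fin.ext rfl

/-- **Left multiplication by `l(a)` on the graded model**, `{c₁, …, cₙ} ↦ {a, c₁, …, cₙ}` (well defined: prefixing a
letter carries multilinearity and Steinberg relations to relations one slot further). [cite: Milnor1970, §1 «generated by symbols l(a), a ∈ F•, subject only to the defining relations l(ab) = l(a) + l(b) and l(a)l(1−a) = 0» (p0002 L18–L20)] -/
def gact (a : Rˣ) : GradedModel R →+ GradedModel R :=
  gradedModelLift R (fun n c => gsymbol R (n + 1) (Fin.cons a c : Fin (n + 1) → Rˣ))
    (fun n c i x y => by simp only [Fin.cons_update]; exact gsymbol_update_mul R _ _ _ _ _)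
    (fun n c i h hsum => gsymbol_eq_zero_of_add_eq_one R _ _ i.succ (by simpa using h) (by
      rw [finSucc_succ i h]; simpa only [MilnorK.cons_apply_succ] using hsum))

/-- `gact a {c} = {a, c}`. [cite: Milnor1970, §1 «generated by symbols l(a), a ∈ F•, subject only to the defining relations l(ab) = l(a) + l(b) and l(a)l(1−a) = 0» (p0002 L18–L20)] -/
theorem gact_gsymbol (a : Rˣ) (n : ℕ) (c : Fin n → Rˣ) :
    gact R a (gsymbol R n c) = gsymbol R (n + 1) (Fin.cons a c : Fin (n + 1) → Rˣ) :=
  gradedModelLift_gsymbol R _ _ _ n c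

/-- **`l(ab)· = l(a)· + l(b)·`** on the graded model (multilinearity in slot `0`). [cite: Milnor1970, §1 «generated by symbols l(a), a ∈ F•, subject only to the defining relations l(ab) = l(a) + l(b) and l(a)l(1−a) = 0» (p0002 L18–L20)] -/
theorem gact_mul (a b : Rˣ) : gact R (a * b) = gact R a + gact R b := by
  refine gradedModel_hom_ext R (fun n c => ?_)
  rw [AddMonoidHom.add_apply, gact_gsymbol, gact_gsymbol, gact_gsymbol]
  have h0 : ∀ z : Rˣ, (Fin.cons z c : Fin (n + 1) → Rˣ) = update (Fin.cons 1 c : Fin (n + 1) → Rˣ) 0 z := fun z => by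
    rw [Fin.update_cons_zero]
  rw [h0 (a * b), h0 a, h0 b]
  exact gsymbol_update_mul R _ _ _ _ _

/-- **`l(a) l(1−a) · = 0`** on the graded model (the Steinberg relation in slots `0, 1`). [cite: Milnor1970, §1 «generated by symbols l(a), a ∈ F•, subject only to the defining relations l(ab) = l(a) + l(b) and l(a)l(1−a) = 0» (p0002 L18–L20)] -/
theorem gact_gact_eq_zero {a b : Rˣ} (h : (a : R) + b = 1) : (gact R a).comp (gact R b) = 0 := by
  refine gradedModel_hom_ext R (fun n c => ?_)
  rw [AddMonoidHom.comp_apply, gact_gsymbol, gact_gsymbol, AddMonoidHom.zero_apply]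
  exact gsymbol_eq_zero_of_add_eq_one R _ _ 0 (by simp) (by simpa [finSucc] using h)

/-- `gact a` as an element of the endomorphism ring of the graded model. [cite: Milnor1970, §1 «generated by symbols l(a), a ∈ F•, subject only to the defining relations l(ab) = l(a) + l(b) and l(a)l(1−a) = 0» (p0002 L18–L20)] -/
def gactEnd (a : Rˣ) : AddMonoid.End (GradedModel R) := gact R a

/-- `gactEnd` unfolded. [cite: Milnor1970, §1 «generated by symbols l(a), a ∈ F•, subject only to the defining relations l(ab) = l(a) + l(b) and l(a)l(1−a) = 0» (p0002 L18–L20)] -/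
theorem gactEnd_apply (a : Rˣ) (v : GradedModel R) : gactEnd R a v = gact R a v := rfl

/-- `l(a) ↦ gact a` as an additive map `K₁R → End(⊕ₙ K_nR)`. [cite: Milnor1970, §1 «generated by symbols l(a), a ∈ F•, subject only to the defining relations l(ab) = l(a) + l(b) and l(a)l(1−a) = 0» (p0002 L18–L20)] -/
def gactHom : Additive Rˣ →+ AddMonoid.End (GradedModel R) :=
  AddMonoidHom.mk' (fun x => gactEnd R (Additive.toMul x)) fun x y => by
    rw [toMul_add]; exact gact_mul R _ _

/-- `gactHom (l a) = gact a`. [cite: Milnor1970, §1 «generated by symbols l(a), a ∈ F•, subject only to the defining relations l(ab) = l(a) + l(b) and l(a)l(1−a) = 0» (p0002 L18–L20)] -/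
theorem gactHom_ofMul (a : Rˣ) : gactHom R (Additive.ofMul a) = gactEnd R a := rfl

/-- **`K_*R` acts on the graded model**: the ring homomorphism `K_*R → End(⊕ₙ K_nR)`, `l(a) ↦ gact a`, through the
universal properties of the tensor algebra and of the quotient by the Steinberg relation («subject only to the
defining relations l(ab) = l(a) + l(b) and l(a)l(1−a) = 0»). [cite: Milnor1970, §1 «generated by symbols l(a), a ∈ F•, subject only to the defining relations l(ab) = l(a) + l(b) and l(a)l(1−a) = 0» (p0002 L18–L20)] -/
def grho : MilnorKStar R →ₐ[ℤ] AddMonoid.End (GradedModel R) :=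
  RingQuot.liftAlgHom ℤ ⟨TensorAlgebra.lift ℤ (gactHom R).toIntLinearMap, by
    rintro x y ⟨a, b, hab, rfl, rfl⟩
    rw [map_mul, TensorAlgebra.lift_ι_apply, TensorAlgebra.lift_ι_apply, map_zero, AddMonoidHom.coe_toIntLinearMap,
      gactHom_ofMul, gactHom_ofMul]
    exact gact_gact_eq_zero R hab⟩

/-- `grho (l a) = gact a`. [cite: Milnor1970, §1 «generated by symbols l(a), a ∈ F•, subject only to the defining relations l(ab) = l(a) + l(b) and l(a)l(1−a) = 0» (p0002 L18–L20)] -/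
theorem grho_l (a : Rˣ) : grho R (l R a) = gactEnd R a := by
  rw [l_def, grho, RingQuot.liftAlgHom_mkAlgHom_apply, TensorAlgebra.lift_ι_apply, AddMonoidHom.coe_toIntLinearMap,
    gactHom_ofMul]

/-- `l(a₁)⋯l(aₙ) · {} = {a₁, …, aₙ}` in the graded model. [cite: Milnor1970, §1 «In other words …» (p0002 L15–L18)] -/
theorem prod_gactEnd_gsymbol_zero {n : ℕ} (a : Fin n → Rˣ) :
    (List.ofFn fun j => gactEnd R (a j)).prod (gsymbol R 0 Fin.elim0) = gsymbol R n a := by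
  induction n with
  | zero =>
    rw [List.ofFn_zero, List.prod_nil, AddMonoid.End.coe_one, id_eq]
    congr 1
    funext i; exact Fin.elim0 i
  | succ n ih =>
    rw [List.ofFn_succ, List.prod_cons, AddMonoid.End.coe_mul, Function.comp_apply, ih (fun j => a j.succ)]
    rw [gactEnd_apply, gact_gsymbol]
    exact congrArg _ (Fin.cons_self_tail a)

/-- **The projection `K_*R → ⊕ₙ K_nR`**, `x ↦ x · {}` (acting on the empty symbol of degree `0`). [cite: Milnor1970, §1 «In other words …» (p0002 L15–L18)] -/
def gproj : MilnorKStar R →+ GradedModel R where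
  toFun x := grho R x (gsymbol R 0 Fin.elim0)
  map_zero' := by rw [map_zero]; rfl
  map_add' x y := by rw [map_add]; rfl

/-- `gproj` unfolded. [cite: Milnor1970, §1 «In other words …» (p0002 L15–L18)] -/
theorem gproj_apply (x : MilnorKStar R) : gproj R x = grho R x (gsymbol R 0 Fin.elim0) := rfl

/-- **`gproj (l(c₁)⋯l(cₙ)) = {c₁, …, cₙ}`**: the projection inverts `ofDeg` on symbols. [cite: Milnor1970, §1 «In other words …» (p0002 L15–L18)] -/
theorem gproj_ofDeg_symbol {n : ℕ} (c : Fin n → Rˣ) : gproj R (ofDeg R n (MilnorK.symbol c)) = gsymbol R n c := by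
  rw [gproj_apply, ofDeg_symbol, map_list_prod, List.map_ofFn]
  have : (⇑(grho R) ∘ fun j => l R (c j)) = fun j => gactEnd R (c j) := funext fun j => grho_l R (c j)
  rw [this, prod_gactEnd_gsymbol_zero]

/-- **The degree-`n` component `⊕ₘ K_mR → K_nR`**: the degree-`n` symbol `{c}` goes to the symbol `{c} ∈ K_nR` of
`MilnorKGroups`, symbols of other degrees to `0` (well defined by `symbol_update_mul`, `symbol_eq_zero_of_add_eq_one`).
[cite: Milnor1970, §1 «In other words each K_nF, n ≥ 2, is the quotient of the n-fold tensor product K₁F ⊗ ⋯ ⊗ K₁F by the subgroup generated by all l(a₁) ⊗ ⋯ ⊗ l(aₙ) such that aᵢ + aᵢ₊₁ = 1 for some i» (p0002 L15–L18)] -/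
def gcomponent (n : ℕ) : GradedModel R →+ MilnorK R n :=
  gradedModelLift R (fun m c => if h : m = n then MilnorK.castEquiv h (MilnorK.symbol c) else 0)
    (fun m c i x y => by
      by_cases h : m = n
      · simp only [dif_pos h, MilnorK.symbol_update_mul, map_add]
      · simp only [dif_neg h, add_zero])
    (fun m c i h' hsum => by
      by_cases h : m = n
      · simp only [dif_pos h, MilnorK.symbol_eq_zero_of_add_eq_one c i h' hsum, map_zero]
      · simp only [dif_neg h])

/-- `gcomponent n {c} = {c}` in degree `n`. [cite: Milnor1970, §1 «In other words …» (p0002 L15–L18)] -/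
theorem gcomponent_gsymbol_self (n : ℕ) (c : Fin n → Rˣ) : gcomponent R n (gsymbol R n c) = MilnorK.symbol c := by
  rw [gcomponent, gradedModelLift_gsymbol, dif_pos rfl, MilnorK.castEquiv_rfl]

/-- `gcomponent n` kills the symbols of the other degrees. [cite: Milnor1970, §1 «In other words …» (p0002 L15–L18)] -/
theorem gcomponent_gsymbol_of_ne {m n : ℕ} (h : m ≠ n) (c : Fin m → Rˣ) : gcomponent R n (gsymbol R m c) = 0 := by
  rw [gcomponent, gradedModelLift_gsymbol, dif_neg h]

/-- **`K_nR → K_*R → ⊕ₘ K_mR → K_nR` is the identity.** [cite: Milnor1970, §1 «In other words each K_nF, n ≥ 2, is the quotient of the n-fold tensor product K₁F ⊗ ⋯ ⊗ K₁F by the subgroup generated by all l(a₁) ⊗ ⋯ ⊗ l(aₙ) such that aᵢ + aᵢ₊₁ = 1 for some i» (p0002 L15–L18)] -/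
theorem gcomponent_gproj_ofDeg {n : ℕ} (x : MilnorK R n) : gcomponent R n (gproj R (ofDeg R n x)) = x := by
  suffices h : ((gcomponent R n).comp (gproj R)).comp (ofDeg R n) = AddMonoidHom.id _ from DFunLike.congr_fun h x
  refine MilnorK.hom_ext (fun c => ?_)
  rw [AddMonoidHom.comp_apply, AddMonoidHom.comp_apply, gproj_ofDeg_symbol, gcomponent_gsymbol_self,
    AddMonoidHom.id_apply]

/-- `K_mR → K_*R → ⊕ K → K_nR` vanishes for `m ≠ n`. [cite: Milnor1970, §1 «In other words …» (p0002 L15–L18)] -/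
theorem gcomponent_gproj_ofDeg_of_ne {m n : ℕ} (h : m ≠ n) (x : MilnorK R m) :
    gcomponent R n (gproj R (ofDeg R m x)) = 0 := by
  suffices h : ((gcomponent R n).comp (gproj R)).comp (ofDeg R m) = 0 from DFunLike.congr_fun h x
  refine MilnorK.hom_ext (fun c => ?_)
  rw [AddMonoidHom.comp_apply, AddMonoidHom.comp_apply, gproj_ofDeg_symbol, gcomponent_gsymbol_of_ne R h,
    AddMonoidHom.zero_apply]

/-- **«In other words»: the canonical map `K_nR → K_*R` is injective** — the degree-`n` part of Milnor's ring `K_*R`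
(tensor algebra modulo the two-sided ideal) is the group `K_nR` (n-fold tensor product modulo the subgroup of the
source). [cite: Milnor1970, §1 «In other words each K_nF, n ≥ 2, is the quotient of the n-fold tensor product K₁F ⊗ ⋯ ⊗ K₁F by the subgroup generated by all l(a₁) ⊗ ⋯ ⊗ l(aₙ) such that aᵢ + aᵢ₊₁ = 1 for some i» (p0002 L15–L18)] -/
theorem ofDeg_injective (n : ℕ) : Function.Injective (ofDeg R n) := fun x y h => by
  rw [← gcomponent_gproj_ofDeg R x, h, gcomponent_gproj_ofDeg]

/-- **The images of the `K_nR` in `K_*R` are independent** (with `iSup_range_ofDeg : ⨆ₙ range (ofDeg n) = ⊤` of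
`MilnorKStar`: `K_*R` is the internal direct sum of the images, «a graded ring K_*F = (K₀F, K₁F, K₂F, …)»).
[cite: Milnor1970, §1 (p0001 L31–L33, p0002 L15–L18)] -/
theorem iSupIndep_range_ofDeg : iSupIndep fun n => (ofDeg R n).range := by
  intro n
  rw [disjoint_iff_inf_le]
  rintro y ⟨⟨x, rfl⟩, hy⟩
  -- `Q := ofDeg n ∘ component n ∘ gproj` fixes `ofDeg n x` and kills the other ranges
  have hQ : ∀ z ∈ ⨆ m, ⨆ (_ : m ≠ n), (ofDeg R m).range, ofDeg R n (gcomponent R n (gproj R z)) = 0 := by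
    intro z hz
    refine AddSubgroup.iSup_induction (C := fun z => ofDeg R n (gcomponent R n (gproj R z)) = 0) _ hz
      (fun m z hz => ?_) (by rw [map_zero, map_zero, map_zero]) (fun a b ha hb => by rw [map_add, map_add, map_add, ha, hb, add_zero])
    refine AddSubgroup.iSup_induction (C := fun z => ofDeg R n (gcomponent R n (gproj R z)) = 0) _ hz
      (fun hm w hw => ?_) (by rw [map_zero, map_zero, map_zero]) (fun a b ha hb => by rw [map_add, map_add, map_add, ha, hb, add_zero])
    obtain ⟨v, rfl⟩ := hw
    rw [gcomponent_gproj_ofDeg_of_ne R hm, map_zero]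
  have := hQ _ hy
  rw [gcomponent_gproj_ofDeg] at this
  rw [AddSubgroup.mem_bot]
  exact this

/-- The map `⊕ₙ K_nR → K_*R`, `{c₁, …, cₙ} ↦ l(c₁)⋯l(cₙ)`. [cite: Milnor1970, §1 «In other words …» (p0002 L15–L18)] -/
def gtotal : GradedModel R →+ MilnorKStar R :=
  gradedModelLift R (fun n c => ofDeg R n (MilnorK.symbol c))
    (fun n c i x y => by rw [MilnorK.symbol_update_mul, map_add])
    (fun n c i h hsum => by rw [MilnorK.symbol_eq_zero_of_add_eq_one c i h hsum, map_zero])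

/-- `gtotal {c} = l(c₁)⋯l(cₙ)`. [cite: Milnor1970, §1 «In other words …» (p0002 L15–L18)] -/
theorem gtotal_gsymbol (n : ℕ) (c : Fin n → Rˣ) : gtotal R (gsymbol R n c) = ofDeg R n (MilnorK.symbol c) :=
  gradedModelLift_gsymbol R _ _ _ n c

/-- `gproj ∘ gtotal = id`. [cite: Milnor1970, §1 «In other words …» (p0002 L15–L18)] -/
theorem gproj_gtotal (v : GradedModel R) : gproj R (gtotal R v) = v := by
  suffices h : (gproj R).comp (gtotal R) = AddMonoidHom.id _ from DFunLike.congr_fun h v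
  exact gradedModel_hom_ext R fun n c => by rw [AddMonoidHom.comp_apply, gtotal_gsymbol, gproj_ofDeg_symbol, AddMonoidHom.id_apply]

/-- `gtotal ∘ gproj = id` (`K_*R` is generated by the images of the `K_nR`, `iSup_range_ofDeg`). [cite: Milnor1970, §1 «In other words …» (p0002 L15–L18)] -/
theorem gtotal_gproj (x : MilnorKStar R) : gtotal R (gproj R x) = x := by
  classical
  have hx : x ∈ (⊤ : AddSubgroup (MilnorKStar R)) := trivial
  rw [← iSup_range_ofDeg] at hx
  refine AddSubgroup.iSup_induction (C := fun y => gtotal R (gproj R y) = y) _ hx (fun n y hy => ?_)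
    (by rw [map_zero, map_zero]) (fun y z hy hz => by rw [map_add, map_add, hy, hz])
  obtain ⟨z, rfl⟩ := hy
  suffices h : ((gtotal R).comp (gproj R)).comp (ofDeg R n) = ofDeg R n from DFunLike.congr_fun h z
  exact MilnorK.hom_ext fun c => by rw [AddMonoidHom.comp_apply, AddMonoidHom.comp_apply, gproj_ofDeg_symbol, gtotal_gsymbol]

/-- **`K_*R ≅ ⊕ₙ K_nR` as additive groups** («a graded ring K_*F = (K₀F, K₁F, K₂F, …)» with the `K_nF` as printed).
[cite: Milnor1970, §1 (p0001 L31–L33, p0002 L15–L18)] -/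
def gradedEquiv : MilnorKStar R ≃+ GradedModel R :=
  { gproj R with
    invFun := gtotal R
    left_inv := gtotal_gproj R
    right_inv := gproj_gtotal R }

/-- `gradedEquiv` is `gproj`. [cite: Milnor1970, §1 «In other words …» (p0002 L15–L18)] -/
theorem gradedEquiv_apply (x : MilnorKStar R) : gradedEquiv R x = gproj R x := rfl

/-- Its inverse is `gtotal`. [cite: Milnor1970, §1 «In other words …» (p0002 L15–L18)] -/
theorem gradedEquiv_symm_apply (v : GradedModel R) : (gradedEquiv R).symm v = gtotal R v := rfl

/-- `gradedEquiv` carries `l(c₁)⋯l(cₙ) = ofDeg {c}` to the degree-`n` symbol `{c}`. [cite: Milnor1970, §1 «In other words …» (p0002 L15–L18)] -/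
theorem gradedEquiv_ofDeg_symbol {n : ℕ} (c : Fin n → Rˣ) :
    gradedEquiv R (ofDeg R n (MilnorK.symbol c)) = gsymbol R n c := gproj_ofDeg_symbol R c

end MilnorKStar

end Graded

end Literature.RingTheory.KTheory

end
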